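import Literature.MathematicalPhysics.QuantumFieldTheory.Balaban1983to89.Beta.RemainderConstAllScales
import Literature.MathematicalPhysics.QuantumFieldTheory.Balaban1983to89.Beta.AveragedAFCarrierCertified

/-!
# Beta / AveragedAFCarrierAllScales — the ALL-SCALES × CONSTANT-REMAINDER road (asym2 `RemainderConstAllScales`, p191686)
# ON THE [III] SIDE: the carrier `BetaAvgAFH`, the whole located [III] list, and the T⁴ cell's flow-fact binders from
# {all-scales one-loop bound `|β⁰_{k+j+1} − β⁰_{k+1}| ≤ κθ^k`} × {one-sided certified list} × {constant-form remainder}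
# (β sub-cell, [III]-side CO-LEAD unit `b2b-balaban-strat-b14` gen 22 (v1) / gen 23 (v1.1 §6); BETA-SPEC §5 (the [III]-side contract); trigger (t1) of MISSING-B14 §9)

HONEST FRAMING (page 1 of everything the β sub-cell writes): discharging `BetaPertH` makes Bałaban's UV stability UNCONDITIONAL — a
real constructive-QFT result; it is NOT the continuum limit and NOT the Clay problem.  THIS MODULE is CLASS-LEVEL BOOKKEEPING: it
composes two LANDED kernel files — asym2's `RemainderConstAllScales` v1 (p191686: the ALL-SCALES shape `AllScalesSeq S.β0 κ θ` of the
one-loop coefficients — NO range of `θ`, NO limit value —, its one-hop floor `m − κθ^{k₁}` from a one-sided certified list, the β-level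
floor `betaLowerH_of_allScalesConst` in the CONSTANT-form remainder socket, the DERIVED printed-type upper bound
`betaUpperH_of_allScales_const`, and the END forms `endpointExistence_of_allScalesConst` / `_cont`, `endpointExistence_of_allScalesChainL` /
`_cont`, `endpointExistence_of_allScalesRateConst_cont`) and this lineage's carrier file `AveragedAFCarrier` v1.8 (p184099; the carrier
`BetaAvgAFH` and its three all-profile consumers) — in the pattern of `AveragedAFCarrierCertified` §4 (margin × constant).  It asserts
nothing printed by Bałaban; every statement is [folklore] bookkeeping over the cell's hypothesis carriers and computational leaves.  The
wall (`BETA/WALL.md` v2.15, BETA-SPEC §7) is UNTOUCHED; road-(1) verdict unchanged (PRECISELY WALLED at END-STATEMENT grade; nothing of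
(D1)/(D4)/(C) discharged); value = the END-statement bookkeeping of the all-scales road on the [III] side, NOT summit progress.

ABSOLUTE RULE (cell charter, verbatim): "No internally-minted statement may enter as a cited fact. Every hypothesis is either
kernel-proved in this package or a verbatim quotation of a PUBLISHED theorem with page reference. The manuscript(s) under audit are
NOT citable for their own disputed steps — they are the thing under adjudication; programme-internal (2001/route/tribunal) claims
are never citable."

## What the binders are (as in `AveragedAFCarrierCertified`; `RemainderConstAllScales` header «HONEST STATUS»)

* `hall : AllScalesSeq S.β0 κ θ` (`|β⁰_{k+j+1} − β⁰_{k+1}| ≤ κθ^k` for ALL `k, j`; no range of `θ`, no limit) — the asymptotic lanes'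
  ALL-SCALES bound: the wall's (D1)+(D3) in all-scales clothing (cell item O-asym1-1, located, NOT printed for (1.22)), NOT a lane output;
* `hlist : ∀ k ≤ k₁, m ≤ S.β0 k` — the computer-assisted lane's COMPUTATIONAL LEAVES (one-sided certified lower values; none is in the
  tree for Bałaban's split);
* `hrem : RemainderConst S γ₀ r` — wall item (D4) (the chain's leaves by name; §2 fills the slot by a window chain `ChainL` under the
  printed-type restriction `ε₁·K_rem,L < m − κθ^{k₁}`);
* the ONE numeric condition `r < m − κθ^{k₁}` (slope > 0: END + (2.46)) resp. `r ≤ m − κθ^{k₁}` (slope ≥ 0: (2.6)–(2.9), C19/C20);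
* `hcont : BetaContH γ₀ β` — (C), wall item (D5); `hup : BetaUpperH β′ γ₀ β`, `0 ≤ β′` — the printed-type upper bound
  ([Balaban1987RG1] p. 264 with (5.10)) as a binder, OR DERIVED on this road (`β′ = β⁰_1 + κ + r`, the `_cont` forms: no `hup`, no `hβ′`);
* `hgen`/`hhalt`/`hcur` + `0 < β₀`, `L ≥ 2`, `p`, `κ₀ ≥ 6` — structural / run-side data of the [III] consumers.
NOTHING ELSE: no `0 < β⁰_∞`, no identification `β⁰_∞ = stepBal N L`, no rate, no limit, no γ-shrinking.  Table 9.1 of MISSING-B14 §9 gains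
no new row: the all-scales road IS the (AF-0s) row `BetaLowerH (m − κθ^{k₁} − r)` ⟼ DEFECT-ZERO carrier, threshold scale `0`.

## Contents

§1 THE CARRIER AND THE CONSUMERS: `betaAvgAFH_of_allScalesConst` (DEFECT-ZERO carrier `BetaAvgAFH (m − κθ^{k₁} − r) 0 γ₀ β`; binders =
all-scales bound + one-sided list + `RemainderConst` — no (C), no upper bound, no DAG, no θ-range), `allScalesConst_END_allProfiles`
(`EndpointExistence ∧ ∃ γ₁ > 0, ∀ γ ≤ min γ₀ γ₁, ∀ runs in ]0,γ], ∀ p′ ≤ p, ∀ A₀ ≥ 0: sizes ∧ HorizonFacts` — (2.6)–(2.9) + (2.46) of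
[Balaban1988Convergent] pp. 255–263 —, `r <` strict), `allScalesConst_flowIneq_allProfiles` ((2.6)–(2.9), NO (2.46), `r ≤`, no (C)),
`allScalesConst_t4FlowInputs` (C19/C20, `r ≤`, no (C)); the (U)-DERIVED forms `betaPrime_derived_nonneg`, `allScalesConst_END_allProfiles_cont`,
`allScalesConst_flowIneq_allProfiles_cont`, `allScalesConst_t4FlowInputs_cont` (no `hup`, no `hβ′`).  §2 CHAIN LEVEL (the remainder slot filled
by asym2/an4's window chain `ChainL`): `allScalesChainL_END_allProfiles` / `_cont`.  §3 THE SHARPER CAUCHY ROAD (`CauchyRate S.β0 c θ`,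
`0 ≤ θ < 1`, floor `m − (c/(1−θ))θ^{k₁}`): `betaAvgAFH_of_cauchyAllScalesConst`, `cauchyAllScalesConst_END_allProfiles`.  §4 THE JOINED KERNEL END
((UD) + `HessKerSchurCauchy.AllScalesRate` under `S.β0 k = secondMoment (P k) μ ν`): `betaAvgAFH_of_allScalesRateConst`,
`allScalesRateConst_END_allProfiles_cont`.  §5 NON-VACUITY on asym2's OSCILLATING split `Witness.splitOsc` (β⁰_{k+1} = 1 + (−1)^k/4: the
all-scales bound holds with `κ = 1/2`, `θ = 1`, the carrier has slope `3/4 > 0`, yet NO `GeomRate`/`CauchyRate` with `θ < 1` holds — the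
all-scales [III] road covers one-loop sequences that no rate road of `AveragedAFCarrierCertified` §1–§8 reaches).
§6 (v1.1) THE TAIL-DROP ROAD ON THE [III] SIDE (asym2 `RemainderConstAllScales` v1.2 §7, the END-grade content of the all-scales hypothesis
— advisory A-lit1g23-1 typed: `TailDrop S.β0 k₁ s := ∀ n ≥ k₁, β⁰(k₁) − s ≤ β⁰(n)`, one level, one side, no `θ`, no limit): `betaAvgAFH_of_tailDropConst`
(DEFECT-ZERO carrier, slope `m − s − r`), `tailDropConst_END_allProfiles` (`r < m − s` STRICT), `tailDropConst_flowIneq_allProfiles` / `_t4FlowInputs`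
(`r ≤ m − s`, no (C)); (U) DERIVED from a level CEILING `S.β0 k ≤ M` (`β′ = M + r`, RCUD `betaUpperH_of_ceiling_const`): `betaPrime_ceiling_nonneg`,
`tailDropCeilingConst_END_allProfiles_cont` / `_flowIneq_allProfiles_cont` / `_t4FlowInputs_cont` (no `hup`, no `hβ′`); consistency: §1 is the case
`htail := hall.tailDrop k₁` (`s = κθ^{k₁}`), §3 the case `tailDrop_of_cauchyRate` (`s = (c/(1−θ))θ^{k₁}`), the Certified margin road the case
`tailDrop_of_geomRate` (`s = c₀(1+θ)θ^{k₁}`); non-vacuity on the oscillating split ONE LEVEL DEEPER (`k₁ = 1`, budget `s = 0`, list `3/4`: the same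
slope `3/4` as §5's depth-`0` road, with the oscillation allowance moved from `s` into the certified list).
VERSIONS: v1 p191999 (gen 22; §1–§5).  v1.1 (gen 23): + §6, APPEND-ONLY — every declaration of v1 byte-identical; theorems and `example`s only.
Source located (consumer locators, quoted verbatim in `B14FlowStep` / `AveragedAFCarrier`, nothing newly quoted): [Balaban1987RG1, Thm 2
p.259, §1 p.264, (2.12)–(2.14) p.268]; [Balaban1988Convergent, (2.5)–(2.9) pp.255–256, (2.28) p.259, (2.46) p.263].
-/

namespace Literature.MathematicalPhysics.QuantumFieldTheory.Balaban1983to89.Beta.AveragedAFCarrierAllScales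

open Literature.MathematicalPhysics.QuantumFieldTheory.Balaban1983to89
open FlowStep FlowStepRuns DagBinding B14DeltaBeta
open Literature.MathematicalPhysics.QuantumFieldTheory.Balaban1983to89.Beta.RemainderChain
open Literature.MathematicalPhysics.QuantumFieldTheory.Balaban1983to89.Beta.RemainderChainLattice
open Literature.MathematicalPhysics.QuantumFieldTheory.Balaban1983to89.Beta.RemainderChainTorus
open Literature.MathematicalPhysics.QuantumFieldTheory.Balaban1983to89.Beta.RateCertificate (GeomRate CauchyRate)
open Literature.MathematicalPhysics.QuantumFieldTheory.Balaban1983to89.B12Sec2to5 (betaPrime510)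
open HessKerSchurCauchy (AllScalesRate)
open RemainderConstCertified RemainderConstAllScales AveragedAFCarrier

noncomputable section

variable {β : HBeta}

/-! ## §1 The carrier and the consumers (all-scales × constant remainder) -/

/-- **ALL-SCALES × CONSTANT REMAINDER ⟹ THE CARRIER, DEFECT ZERO**: (asym) `AllScalesSeq S.β0 κ θ` — no range of `θ`, no limit;
(cap) the one-sided list `m ≤ S.β0 k` for all `k ≤ k₁`; (asym2/an4) `RemainderConst S γ₀ r` ⟹ `BetaAvgAFH (m − κθ^{k₁} − r) 0 γ₀ β`
— asym2's `betaLowerH_of_allScalesConst` fed to `betaAvgAFH_of_betaLowerH`.  No (C), no upper bound, no DAG, no `0 < β⁰_∞`; the slope is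
positive iff `r < m − κθ^{k₁}` (asym2's ONE inequality). [cite: Balaban1987RG1, (2.12)–(2.14) p.268] -/
theorem betaAvgAFH_of_allScalesConst (S : B12Beta.OneLoopSplit β) {γ₀ κ θ r m : ℝ} {k₁ : ℕ}
    (hall : AllScalesSeq S.β0 κ θ) (hlist : ∀ k, k ≤ k₁ → m ≤ S.β0 k) (hrem : RemainderConst S γ₀ r) :
    BetaAvgAFH (m - κ * θ ^ k₁ - r) 0 γ₀ β :=
  betaAvgAFH_of_betaLowerH (betaLowerH_of_allScalesConst S hall hlist hrem)

/-- **ALL-SCALES × CONSTANT REMAINDER ⟹ THE END STATEMENT, [III] SIDE, ALL PROFILES**: the binders of asym2's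
`thm2Printed_of_allScalesConst` minus `L`/`hL` (all-scales bound, one-sided list, `RemainderConst` with `r < m − κθ^{k₁}` STRICTLY, (C),
(U) with `β′ ≥ 0`) + the [III] run-side data ⟹ `EndpointExistence C ∧ ∃ γ₁ > 0, ∀ γ ≤ min γ₀ γ₁, ∀ runs in ]0,γ], ∀ p′ ≤ p, ∀ A₀ ≥ 0:
sizes ∧ HorizonFacts` ((2.6)–(2.9) + (2.46)), every `β₀ > 0`.
[cite: Balaban1987RG1, Thm 2 p.259 and Thm 3 p.264] [cite: Balaban1988Convergent, (2.5)–(2.9) pp.255–256, (2.28) p.259, (2.46) p.263] -/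
theorem allScalesConst_END_allProfiles {C : B12.Construction} (hgen : ForwardGenerated C β) (hhalt : HaltsOutside C β)
    (hcur : CurriesHBeta C β) (S : B12Beta.OneLoopSplit β) {γ₀ κ θ r β' m : ℝ} {k₁ : ℕ} (hγ₀ : 0 < γ₀)
    (hall : AllScalesSeq S.β0 κ θ) (hlist : ∀ k, k ≤ k₁ → m ≤ S.β0 k)
    (hrem : RemainderConst S γ₀ r) (hr : r < m - κ * θ ^ k₁)
    (hcont : BetaContH γ₀ β) (hup : BetaUpperH β' γ₀ β) (hβ' : 0 ≤ β')
    {β₀ : ℝ} (hβ₀ : 0 < β₀) {L : ℕ} (hL2 : 2 ≤ L) (p : ℕ) {κ₀ : ℕ} (hκ : 6 ≤ κ₀) :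
    EndpointExistence C ∧ ∃ γ₁ : ℝ, 0 < γ₁ ∧
      ∀ γ : ℝ, 0 < γ → γ ≤ min γ₀ γ₁ → ∀ Pr : B12.RunParams, (C Pr).flow.InInterval γ Pr.K →
        ∀ p' : ℕ, p' ≤ p → ∀ A₀ : ℝ, 0 ≤ A₀ →
          ∃ Rj : ℕ → ℕ, (∀ j, B14.IsRj L p' ((C Pr).flow.g j) (Rj j)) ∧
            HorizonFacts (C Pr).flow β' β₀ A₀ L p' κ₀ Rj Pr.K :=
  (betaAvgAFH_of_allScalesConst S hall hlist hrem).endpoint_and_flowControl_allProfiles (sub_pos.mpr hr) hgen hhalt hcur hγ₀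
    hβ' hβ₀ hL2 p hcont hup hκ

/-- **ALL-SCALES × CONSTANT REMAINDER AT SLOPE ≥ 0 ⟹ (2.6)–(2.9) FOR ALL PROFILES, WITHOUT (2.46)** (`r ≤ m − κθ^{k₁}`; NO continuity).
[cite: Balaban1988Convergent, (2.5)–(2.9) pp.255–256] -/
theorem allScalesConst_flowIneq_allProfiles {C : B12.Construction} (hgen : ForwardGenerated C β) (hhalt : HaltsOutside C β)
    (hcur : CurriesHBeta C β) (S : B12Beta.OneLoopSplit β) {γ₀ κ θ r β' m : ℝ} {k₁ : ℕ} (hγ₀ : 0 < γ₀)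
    (hall : AllScalesSeq S.β0 κ θ) (hlist : ∀ k, k ≤ k₁ → m ≤ S.β0 k)
    (hrem : RemainderConst S γ₀ r) (hr : r ≤ m - κ * θ ^ k₁) (hup : BetaUpperH β' γ₀ β) (hβ' : 0 ≤ β')
    {β₀ : ℝ} (hβ₀ : 0 < β₀) {L : ℕ} (hL2 : 2 ≤ L) (p : ℕ) :
    ∃ γ₁ : ℝ, 0 < γ₁ ∧
      ∀ γ : ℝ, 0 < γ → γ ≤ min γ₀ γ₁ → ∀ Pr : B12.RunParams, (C Pr).flow.InInterval γ Pr.K →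
        ∀ p' : ℕ, p' ≤ p → ∀ A₀ : ℝ, 0 ≤ A₀ →
          ∃ Rj : ℕ → ℕ, (∀ j, B14.IsRj L p' ((C Pr).flow.g j) (Rj j)) ∧
            B14.FlowIneq26 (C Pr).flow.g β' β₀ Pr.K ∧ B14.FlowIneq27 (C Pr).flow.g β' β₀ p' Pr.K ∧
            B14.FlowIneq28 (epsK A₀ p' (C Pr).flow) (C Pr).flow.g β' β₀ Pr.K ∧
            B14FlowStep.FlowIneq29 Rj (C Pr).flow.g L β' β₀ Pr.K :=
  (betaAvgAFH_of_allScalesConst S hall hlist hrem).flowIneq_allProfiles (sub_nonneg.mpr hr) hgen hhalt hcur hγ₀ hβ' hβ₀ hL2 p hup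

/-- **ALL-SCALES × CONSTANT REMAINDER AT SLOPE ≥ 0 ⟹ THE T⁴ CELL's FLOW-FACT BINDERS** (C19/C20; NO continuity).
[cite: Balaban1988Convergent, (2.5)–(2.9) pp.255–256] -/
theorem allScalesConst_t4FlowInputs {C : B12.Construction} (hgen : ForwardGenerated C β) (hhalt : HaltsOutside C β)
    (hcur : CurriesHBeta C β) (S : B12Beta.OneLoopSplit β) {γ₀ κ θ r β' m : ℝ} {k₁ : ℕ} (hγ₀ : 0 < γ₀)
    (hall : AllScalesSeq S.β0 κ θ) (hlist : ∀ k, k ≤ k₁ → m ≤ S.β0 k)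
    (hrem : RemainderConst S γ₀ r) (hr : r ≤ m - κ * θ ^ k₁) (hup : BetaUpperH β' γ₀ β) (hβ' : 0 ≤ β')
    {β₀ : ℝ} (hβ₀ : 0 < β₀) {L : ℕ} (hL2 : 2 ≤ L) {p₀ r' : ℕ} (hr' : r' ≤ p₀) :
    ∃ γ₁ : ℝ, 0 < γ₁ ∧ ∀ γ : ℝ, 0 < γ → γ ≤ min γ₀ γ₁ → ∀ Pr : B12.RunParams, (C Pr).flow.InInterval γ Pr.K →
      B14.FlowIneq27 (C Pr).flow.g β' β₀ p₀ Pr.K ∧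
      (∀ j, j ≤ Pr.K → 1 ≤ Real.log (((C Pr).flow.g j) ^ 2)⁻¹) ∧
      ∃ Rj : ℕ → ℕ, (∀ j, B14.IsRj L r' ((C Pr).flow.g j) (Rj j)) ∧ B14FlowStep.FlowIneq29 Rj (C Pr).flow.g L β' β₀ Pr.K :=
  (betaAvgAFH_of_allScalesConst S hall hlist hrem).t4FlowInputs_of_nonneg (sub_nonneg.mpr hr) hgen hhalt hcur hγ₀ hβ' hβ₀ hL2 hr'
    hup

/-! ### (U) DERIVED on the all-scales road: no `hup`, no `hβ′` -/

/-- On the all-scales × constant road the DERIVED upper constant `β′ = β⁰_1 + κ + r` (asym2's `betaUpperH_of_allScales_const`) is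
non-negative under the list at `k = 0`, the slope condition `r ≤ m − κθ^{k₁}` and a non-empty box (`0 ≤ r` by
`remainderConst_nonneg`, `0 ≤ κθ^{k₁}`, `0 ≤ κ`). [folklore] -/
theorem betaPrime_derived_nonneg (S : B12Beta.OneLoopSplit β) {γ₀ κ θ r m : ℝ} {k₁ : ℕ} (hγ₀ : 0 < γ₀)
    (hall : AllScalesSeq S.β0 κ θ) (hlist : ∀ k, k ≤ k₁ → m ≤ S.β0 k) (hrem : RemainderConst S γ₀ r)
    (hr : r ≤ m - κ * θ ^ k₁) : 0 ≤ S.β0 0 + κ + r := by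
  have h0 : m ≤ S.β0 0 := hlist 0 (Nat.zero_le _)
  have hκ : 0 ≤ κ := hall.const_nonneg
  have hs : 0 ≤ κ * θ ^ k₁ := hall.slack_nonneg k₁
  have hr0 : 0 ≤ r := remainderConst_nonneg S hγ₀ hrem
  linarith

/-- **END + THE [III] LIST, ALL PROFILES, (U) DERIVED** (`β′ = β⁰_1 + κ + r`): binders DAG/run-side, `S`, `hall`, `hlist`, `hrem`,
`r < m − κθ^{k₁}`, (C), `0 < β₀`, `L ≥ 2`, `p`, `κ₀ ≥ 6` — no `hup`, no `hβ′`.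
[cite: Balaban1987RG1, Thm 2 p.259 and Thm 3 p.264] [cite: Balaban1988Convergent, (2.5)–(2.9) pp.255–256, (2.28) p.259, (2.46) p.263] -/
theorem allScalesConst_END_allProfiles_cont {C : B12.Construction} (hgen : ForwardGenerated C β) (hhalt : HaltsOutside C β)
    (hcur : CurriesHBeta C β) (S : B12Beta.OneLoopSplit β) {γ₀ κ θ r m : ℝ} {k₁ : ℕ} (hγ₀ : 0 < γ₀)
    (hall : AllScalesSeq S.β0 κ θ) (hlist : ∀ k, k ≤ k₁ → m ≤ S.β0 k)
    (hrem : RemainderConst S γ₀ r) (hr : r < m - κ * θ ^ k₁) (hcont : BetaContH γ₀ β)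
    {β₀ : ℝ} (hβ₀ : 0 < β₀) {L : ℕ} (hL2 : 2 ≤ L) (p : ℕ) {κ₀ : ℕ} (hκ : 6 ≤ κ₀) :
    EndpointExistence C ∧ ∃ γ₁ : ℝ, 0 < γ₁ ∧
      ∀ γ : ℝ, 0 < γ → γ ≤ min γ₀ γ₁ → ∀ Pr : B12.RunParams, (C Pr).flow.InInterval γ Pr.K →
        ∀ p' : ℕ, p' ≤ p → ∀ A₀ : ℝ, 0 ≤ A₀ →
          ∃ Rj : ℕ → ℕ, (∀ j, B14.IsRj L p' ((C Pr).flow.g j) (Rj j)) ∧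
            HorizonFacts (C Pr).flow (S.β0 0 + κ + r) β₀ A₀ L p' κ₀ Rj Pr.K :=
  allScalesConst_END_allProfiles hgen hhalt hcur S hγ₀ hall hlist hrem hr hcont (betaUpperH_of_allScales_const S hall hrem)
    (betaPrime_derived_nonneg S hγ₀ hall hlist hrem hr.le) hβ₀ hL2 p hκ

/-- **(2.6)–(2.9) FOR ALL PROFILES AT SLOPE ≥ 0, (U) DERIVED** — no `hup`, no `hβ′`, no (C). [cite: Balaban1988Convergent, (2.5)–(2.9) pp.255–256] -/
theorem allScalesConst_flowIneq_allProfiles_cont {C : B12.Construction} (hgen : ForwardGenerated C β) (hhalt : HaltsOutside C β)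
    (hcur : CurriesHBeta C β) (S : B12Beta.OneLoopSplit β) {γ₀ κ θ r m : ℝ} {k₁ : ℕ} (hγ₀ : 0 < γ₀)
    (hall : AllScalesSeq S.β0 κ θ) (hlist : ∀ k, k ≤ k₁ → m ≤ S.β0 k)
    (hrem : RemainderConst S γ₀ r) (hr : r ≤ m - κ * θ ^ k₁)
    {β₀ : ℝ} (hβ₀ : 0 < β₀) {L : ℕ} (hL2 : 2 ≤ L) (p : ℕ) :
    ∃ γ₁ : ℝ, 0 < γ₁ ∧
      ∀ γ : ℝ, 0 < γ → γ ≤ min γ₀ γ₁ → ∀ Pr : B12.RunParams, (C Pr).flow.InInterval γ Pr.K →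
        ∀ p' : ℕ, p' ≤ p → ∀ A₀ : ℝ, 0 ≤ A₀ →
          ∃ Rj : ℕ → ℕ, (∀ j, B14.IsRj L p' ((C Pr).flow.g j) (Rj j)) ∧
            B14.FlowIneq26 (C Pr).flow.g (S.β0 0 + κ + r) β₀ Pr.K ∧ B14.FlowIneq27 (C Pr).flow.g (S.β0 0 + κ + r) β₀ p' Pr.K ∧
            B14.FlowIneq28 (epsK A₀ p' (C Pr).flow) (C Pr).flow.g (S.β0 0 + κ + r) β₀ Pr.K ∧
            B14FlowStep.FlowIneq29 Rj (C Pr).flow.g L (S.β0 0 + κ + r) β₀ Pr.K :=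
  allScalesConst_flowIneq_allProfiles hgen hhalt hcur S hγ₀ hall hlist hrem hr (betaUpperH_of_allScales_const S hall hrem)
    (betaPrime_derived_nonneg S hγ₀ hall hlist hrem hr) hβ₀ hL2 p

/-- **THE T⁴ CELL's FLOW-FACT BINDERS AT SLOPE ≥ 0, (U) DERIVED** — no `hup`, no `hβ′`, no (C). [cite: Balaban1988Convergent, (2.5)–(2.9) pp.255–256] -/
theorem allScalesConst_t4FlowInputs_cont {C : B12.Construction} (hgen : ForwardGenerated C β) (hhalt : HaltsOutside C β)
    (hcur : CurriesHBeta C β) (S : B12Beta.OneLoopSplit β) {γ₀ κ θ r m : ℝ} {k₁ : ℕ} (hγ₀ : 0 < γ₀)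
    (hall : AllScalesSeq S.β0 κ θ) (hlist : ∀ k, k ≤ k₁ → m ≤ S.β0 k)
    (hrem : RemainderConst S γ₀ r) (hr : r ≤ m - κ * θ ^ k₁)
    {β₀ : ℝ} (hβ₀ : 0 < β₀) {L : ℕ} (hL2 : 2 ≤ L) {p₀ r' : ℕ} (hr' : r' ≤ p₀) :
    ∃ γ₁ : ℝ, 0 < γ₁ ∧ ∀ γ : ℝ, 0 < γ → γ ≤ min γ₀ γ₁ → ∀ Pr : B12.RunParams, (C Pr).flow.InInterval γ Pr.K →
      B14.FlowIneq27 (C Pr).flow.g (S.β0 0 + κ + r) β₀ p₀ Pr.K ∧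
      (∀ j, j ≤ Pr.K → 1 ≤ Real.log (((C Pr).flow.g j) ^ 2)⁻¹) ∧
      ∃ Rj : ℕ → ℕ, (∀ j, B14.IsRj L r' ((C Pr).flow.g j) (Rj j)) ∧
        B14FlowStep.FlowIneq29 Rj (C Pr).flow.g L (S.β0 0 + κ + r) β₀ Pr.K :=
  allScalesConst_t4FlowInputs hgen hhalt hcur S hγ₀ hall hlist hrem hr (betaUpperH_of_allScales_const S hall hrem)
    (betaPrime_derived_nonneg S hγ₀ hall hlist hrem hr) hβ₀ hL2 hr'

/-! ## §2 Chain level: the remainder slot filled by asym2/an4's window chain `ChainL` (wall item (D4) as fields) -/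

variable {d : ℕ}

/-- **END + THE [III] LIST from the three lanes, the remainder slot filled by a WINDOW CHAIN** `R : ChainL d M μ ν S γ₀ c ℓ α₂ B₃` under
`CondsL`, `R22gen`, the printed signs and the ONE condition `ε₁·K_rem,L < m − κθ^{k₁}` (`ChainL.abs_beta1_le` ∘ §1).  Binders and their
status as in asym2's `thm2Printed_of_allScalesChainL`: `hgen`/`hhalt`/`hcur` MODELLING / run-side; `hall` asym (LOCATED-UNPRINTED,
O-asym1-1); `hlist` cap (COMPUTATIONAL LEAVES); `R, hC, h22, hs, hd, hM` an4 ∕ asym2 (printed leaves as fields); `hε₁` printed-TYPE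
restriction; `hcont` (C); `hup` (U).  NOT Theorem 2, NOT the wall.
[cite: Balaban1987RG1, Thm 2 p.259 and Thm 3 p.264] [cite: Balaban1988RG2Cluster, (2.38) p.20 and p.21]
[cite: Balaban1988Convergent, (2.5)–(2.9) pp.255–256, (2.46) p.263] -/
theorem allScalesChainL_END_allProfiles {C : B12.Construction} (hgen : ForwardGenerated C β) (hhalt : HaltsOutside C β)
    (hcur : CurriesHBeta C β) (S : B12Beta.OneLoopSplit β) {M : ℕ} {μ ν : Fin d} {γ₀ : ℝ} {c : B13.Consts} {ℓ α₂ B₃ : ℝ}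
    (R : ChainL d M μ ν S γ₀ c ℓ α₂ B₃) (hC : CondsL d c ℓ) (h22 : c.R22gen ℓ) (hs : SignsL c α₂ B₃) (hd : 0 < d)
    (hM : 0 < M) {κ θ β' m : ℝ} {k₁ : ℕ} (hγ₀ : 0 < γ₀) (hall : AllScalesSeq S.β0 κ θ)
    (hlist : ∀ k, k ≤ k₁ → m ≤ S.β0 k) (hε₁ : c.ε₁ * remCoeffL d M c α₂ B₃ < m - κ * θ ^ k₁)
    (hcont : BetaContH γ₀ β) (hup : BetaUpperH β' γ₀ β) (hβ' : 0 ≤ β')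
    {β₀ : ℝ} (hβ₀ : 0 < β₀) {L : ℕ} (hL2 : 2 ≤ L) (p : ℕ) {κ₀ : ℕ} (hκ : 6 ≤ κ₀) :
    EndpointExistence C ∧ ∃ γ₁ : ℝ, 0 < γ₁ ∧
      ∀ γ : ℝ, 0 < γ → γ ≤ min γ₀ γ₁ → ∀ Pr : B12.RunParams, (C Pr).flow.InInterval γ Pr.K →
        ∀ p' : ℕ, p' ≤ p → ∀ A₀ : ℝ, 0 ≤ A₀ →
          ∃ Rj : ℕ → ℕ, (∀ j, B14.IsRj L p' ((C Pr).flow.g j) (Rj j)) ∧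
            HorizonFacts (C Pr).flow β' β₀ A₀ L p' κ₀ Rj Pr.K :=
  allScalesConst_END_allProfiles hgen hhalt hcur S hγ₀ hall hlist (R.abs_beta1_le hC h22 hs hd hM) hε₁ hcont hup hβ' hβ₀ hL2 p hκ

/-- … (U) DERIVED (`β′ = β⁰_1 + κ + ε₁·K_rem,L`), no `hup`, no `hβ′`.
[cite: Balaban1987RG1, Thm 2 p.259 and Thm 3 p.264] [cite: Balaban1988RG2Cluster, (2.38) p.20 and p.21]
[cite: Balaban1988Convergent, (2.5)–(2.9) pp.255–256, (2.46) p.263] -/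
theorem allScalesChainL_END_allProfiles_cont {C : B12.Construction} (hgen : ForwardGenerated C β) (hhalt : HaltsOutside C β)
    (hcur : CurriesHBeta C β) (S : B12Beta.OneLoopSplit β) {M : ℕ} {μ ν : Fin d} {γ₀ : ℝ} {c : B13.Consts} {ℓ α₂ B₃ : ℝ}
    (R : ChainL d M μ ν S γ₀ c ℓ α₂ B₃) (hC : CondsL d c ℓ) (h22 : c.R22gen ℓ) (hs : SignsL c α₂ B₃) (hd : 0 < d)
    (hM : 0 < M) {κ θ m : ℝ} {k₁ : ℕ} (hγ₀ : 0 < γ₀) (hall : AllScalesSeq S.β0 κ θ)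
    (hlist : ∀ k, k ≤ k₁ → m ≤ S.β0 k) (hε₁ : c.ε₁ * remCoeffL d M c α₂ B₃ < m - κ * θ ^ k₁)
    (hcont : BetaContH γ₀ β) {β₀ : ℝ} (hβ₀ : 0 < β₀) {L : ℕ} (hL2 : 2 ≤ L) (p : ℕ) {κ₀ : ℕ} (hκ : 6 ≤ κ₀) :
    EndpointExistence C ∧ ∃ γ₁ : ℝ, 0 < γ₁ ∧
      ∀ γ : ℝ, 0 < γ → γ ≤ min γ₀ γ₁ → ∀ Pr : B12.RunParams, (C Pr).flow.InInterval γ Pr.K →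
        ∀ p' : ℕ, p' ≤ p → ∀ A₀ : ℝ, 0 ≤ A₀ →
          ∃ Rj : ℕ → ℕ, (∀ j, B14.IsRj L p' ((C Pr).flow.g j) (Rj j)) ∧
            HorizonFacts (C Pr).flow (S.β0 0 + κ + c.ε₁ * remCoeffL d M c α₂ B₃) β₀ A₀ L p' κ₀ Rj Pr.K :=
  allScalesConst_END_allProfiles_cont hgen hhalt hcur S hγ₀ hall hlist (R.abs_beta1_le hC h22 hs hd hM) hε₁ hcont hβ₀ hL2 p hκ

/-! ## §3 The sharper CAUCHY road on the [III] side (`CauchyRate S.β0 c θ`, `0 ≤ θ < 1`; floor `m − (c/(1−θ))θ^{k₁}`, vs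
`AveragedAFCarrierCertified.evCauchyMarginConst_END_allProfiles` / RCC §7 with the extra factor `(1+θ)`) -/

/-- **ONE-STEP CAUCHY RATE × CONSTANT ⟹ THE CARRIER, DEFECT ZERO, SHARPER FLOOR** `BetaAvgAFH (m − (c/(1−θ))θ^{k₁} − r) 0 γ₀ β`
(asym2's `betaLowerH_of_cauchyAllScalesConst`; the constructed limit never appears). [cite: Balaban1987RG1, (2.12)–(2.14) p.268] -/
theorem betaAvgAFH_of_cauchyAllScalesConst (S : B12Beta.OneLoopSplit β) {γ₀ c θ r m : ℝ} {k₁ : ℕ} (hθ0 : 0 ≤ θ)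
    (hθ1 : θ < 1) (hrate : CauchyRate S.β0 c θ) (hlist : ∀ k, k ≤ k₁ → m ≤ S.β0 k) (hrem : RemainderConst S γ₀ r) :
    BetaAvgAFH (m - c / (1 - θ) * θ ^ k₁ - r) 0 γ₀ β :=
  betaAvgAFH_of_betaLowerH (betaLowerH_of_cauchyAllScalesConst S hθ0 hθ1 hrate hlist hrem)

/-- **ONE-STEP CAUCHY RATE × CONSTANT ⟹ END + THE [III] LIST, ALL PROFILES**, condition `r < m − (c/(1−θ))θ^{k₁}` (SHARPER by the
factor `(1+θ)` than the Cauchy-margin road). [cite: Balaban1987RG1, Thm 2 p.259 and Thm 3 p.264]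
[cite: Balaban1988Convergent, (2.5)–(2.9) pp.255–256, (2.28) p.259, (2.46) p.263] -/
theorem cauchyAllScalesConst_END_allProfiles {C : B12.Construction} (hgen : ForwardGenerated C β) (hhalt : HaltsOutside C β)
    (hcur : CurriesHBeta C β) (S : B12Beta.OneLoopSplit β) {γ₀ c θ r β' m : ℝ} {k₁ : ℕ} (hγ₀ : 0 < γ₀)
    (hθ0 : 0 ≤ θ) (hθ1 : θ < 1) (hrate : CauchyRate S.β0 c θ) (hlist : ∀ k, k ≤ k₁ → m ≤ S.β0 k)
    (hrem : RemainderConst S γ₀ r) (hr : r < m - c / (1 - θ) * θ ^ k₁)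
    (hcont : BetaContH γ₀ β) (hup : BetaUpperH β' γ₀ β) (hβ' : 0 ≤ β')
    {β₀ : ℝ} (hβ₀ : 0 < β₀) {L : ℕ} (hL2 : 2 ≤ L) (p : ℕ) {κ₀ : ℕ} (hκ : 6 ≤ κ₀) :
    EndpointExistence C ∧ ∃ γ₁ : ℝ, 0 < γ₁ ∧
      ∀ γ : ℝ, 0 < γ → γ ≤ min γ₀ γ₁ → ∀ Pr : B12.RunParams, (C Pr).flow.InInterval γ Pr.K →
        ∀ p' : ℕ, p' ≤ p → ∀ A₀ : ℝ, 0 ≤ A₀ →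
          ∃ Rj : ℕ → ℕ, (∀ j, B14.IsRj L p' ((C Pr).flow.g j) (Rj j)) ∧
            HorizonFacts (C Pr).flow β' β₀ A₀ L p' κ₀ Rj Pr.K :=
  allScalesConst_END_allProfiles hgen hhalt hcur S hγ₀ (allScalesSeq_of_cauchyRate hrate hθ0 hθ1) hlist hrem hr hcont hup hβ'
    hβ₀ hL2 p hκ

/-! ## §4 The joined KERNEL END on the [III] side ((UD) + `HessKerSchurCauchy.AllScalesRate` under the identification
`S.β0 k = secondMoment (P k) μ ν`, (1.22) at zero couplings; asym2 §5) -/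

section Kernel

variable {D : ℕ}

/-- **(UD) + ALL-SCALES KERNEL BOUND × CONSTANT ⟹ THE CARRIER, DEFECT ZERO** with `κ = betaPrime510 D C′ δ′` (asym2's
`allScalesSeq_secondMoment`, no range of `θ`, no limit kernel). [cite: Balaban1987RG1, (1.22) p.264 and (2.12)–(2.14) p.268] -/
theorem betaAvgAFH_of_allScalesRateConst (S : B12Beta.OneLoopSplit β) {P : ℕ → B12Beta.Kernel D} {μ ν : Fin D}
    {Cu δ C' δ' θ : ℝ} (hβ0 : ∀ k, S.β0 k = B12Beta.secondMoment (P k) μ ν) (hU : LimitRate.UniformDecay P μ ν Cu δ)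
    (hA : AllScalesRate P μ ν C' δ' θ) (hδ : 0 < δ) (hδ' : 0 < δ') {γ₀ r m : ℝ} {k₁ : ℕ}
    (hlist : ∀ k, k ≤ k₁ → m ≤ S.β0 k) (hrem : RemainderConst S γ₀ r) :
    BetaAvgAFH (m - betaPrime510 D C' δ' * θ ^ k₁ - r) 0 γ₀ β :=
  betaAvgAFH_of_allScalesConst S ((allScalesSeq_secondMoment hU hA hδ hδ').congr hβ0) hlist hrem

/-- **(UD) + ALL-SCALES KERNEL BOUND × CONSTANT ⟹ END + THE [III] LIST, ALL PROFILES, (U) DERIVED**: binders DAG/run-side, `S`,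
`hβ0` (the identification), (UD) `hU` (`δ > 0`), `AllScalesRate P μ ν C′ δ′ θ` (`δ′ > 0`), the one-sided list, `RemainderConst S γ₀ r`, the
ONE condition `r < m − betaPrime510 D C′ δ′·θ^{k₁}`, (C), `0 < β₀`, `L ≥ 2`, `p`, `κ₀ ≥ 6` — no `hup`, no `hβ′`, no θ-range, no limit kernel.
[cite: Balaban1987RG1, (1.22) p.264, Thm 2 p.259 and Thm 3 p.264] [cite: Balaban1988Convergent, (2.5)–(2.9) pp.255–256, (2.46) p.263] -/
theorem allScalesRateConst_END_allProfiles_cont {C : B12.Construction} (hgen : ForwardGenerated C β) (hhalt : HaltsOutside C β)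
    (hcur : CurriesHBeta C β) (S : B12Beta.OneLoopSplit β) {P : ℕ → B12Beta.Kernel D} {μ ν : Fin D} {Cu δ C' δ' θ : ℝ}
    (hβ0 : ∀ k, S.β0 k = B12Beta.secondMoment (P k) μ ν) (hU : LimitRate.UniformDecay P μ ν Cu δ)
    (hA : AllScalesRate P μ ν C' δ' θ) (hδ : 0 < δ) (hδ' : 0 < δ') {γ₀ r m : ℝ} {k₁ : ℕ} (hγ₀ : 0 < γ₀)
    (hlist : ∀ k, k ≤ k₁ → m ≤ S.β0 k) (hrem : RemainderConst S γ₀ r) (hr : r < m - betaPrime510 D C' δ' * θ ^ k₁)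
    (hcont : BetaContH γ₀ β) {β₀ : ℝ} (hβ₀ : 0 < β₀) {L : ℕ} (hL2 : 2 ≤ L) (p : ℕ) {κ₀ : ℕ} (hκ : 6 ≤ κ₀) :
    EndpointExistence C ∧ ∃ γ₁ : ℝ, 0 < γ₁ ∧
      ∀ γ : ℝ, 0 < γ → γ ≤ min γ₀ γ₁ → ∀ Pr : B12.RunParams, (C Pr).flow.InInterval γ Pr.K →
        ∀ p' : ℕ, p' ≤ p → ∀ A₀ : ℝ, 0 ≤ A₀ →
          ∃ Rj : ℕ → ℕ, (∀ j, B14.IsRj L p' ((C Pr).flow.g j) (Rj j)) ∧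
            HorizonFacts (C Pr).flow (S.β0 0 + betaPrime510 D C' δ' + r) β₀ A₀ L p' κ₀ Rj Pr.K :=
  allScalesConst_END_allProfiles_cont hgen hhalt hcur S hγ₀ ((allScalesSeq_secondMoment hU hA hδ hδ').congr hβ0) hlist hrem hr
    hcont hβ₀ hL2 p hκ

end Kernel

/-! ## §5 Non-vacuity on asym2's OSCILLATING split (no rate road reaches it; the all-scales road does, with positive slope) -/

namespace Witness

open RemainderConstAllScales.Witness (oscFamily splitOsc allScalesSeq_splitOsc list_splitOsc remainderConst_splitOsc
  not_geomRate_splitOsc not_cauchyRate_splitOsc)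

/-- On asym2's oscillating split (`β⁰_{k+1} = 1 + (−1)^k/4`, `β¹ ≡ 0`; all-scales bound with `κ = 1/2`, `θ = 1`; list `5/4 ≤ β⁰_1`;
`RemainderConst … 1 0`) §1 gives the DEFECT-ZERO carrier `BetaAvgAFH (5/4 − (1/2)·1^0 − 0) 0 1 oscFamily`. [folklore] -/
theorem allScalesConst_carrier_osc : BetaAvgAFH (5 / 4 - 1 / 2 * (1 : ℝ) ^ 0 - 0) 0 1 oscFamily :=
  betaAvgAFH_of_allScalesConst splitOsc allScalesSeq_splitOsc list_splitOsc remainderConst_splitOsc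

/-- … whose slope `3/4` is POSITIVE, so every consumer of §1 applies to this family. [folklore] -/
theorem allScalesConst_carrier_osc_slope_pos : (0 : ℝ) < 5 / 4 - 1 / 2 * (1 : ℝ) ^ 0 - 0 := by norm_num

/-- … while NO geometric rate with `0 ≤ θ < 1` — the `hconv` binder of `AveragedAFCarrierCertified` §1/§4 — and NO one-step Cauchy
rate with `0 ≤ θ < 1` — the binder of §3 — holds for it (asym2's `not_geomRate_splitOsc` / `not_cauchyRate_splitOsc`, by name): the
all-scales [III] road is NOT subsumed by the rate roads. [folklore] -/
theorem osc_not_reached_by_rate_roads {binf c₀ c θ : ℝ} (hθ0 : 0 ≤ θ) (hθ1 : θ < 1) :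
    ¬ GeomRate splitOsc.β0 binf c₀ θ ∧ ¬ CauchyRate splitOsc.β0 c θ :=
  ⟨not_geomRate_splitOsc hθ0 hθ1, not_cauchyRate_splitOsc hθ0 hθ1⟩

end Witness

/-! ## §6 (v1.1) The TAIL-DROP road on the [III] side (asym2 `RemainderConstAllScales` v1.2 §7: the END-grade content of the
all-scales hypothesis — advisory A-lit1g23-1 typed)

What §1's floor consumes of `hall : AllScalesSeq S.β0 κ θ` is its instance at the SINGLE level `k = k₁`, read ONE-SIDEDLY
(`AllScalesSeq.lower_of_list`); asym2's v1.2 §7 types that reading as `TailDrop S.β0 k₁ s` («from level `k₁` on, β⁰ never drops more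
than `s` below β⁰(k₁)») and feeds RCC's floor sockets with it.  This section is the [III] side of that road, in the pattern of §1:
binders = tail drop at the certified depth + one-sided certified list + `RemainderConst` (+ (C), (U) or a level ceiling for the END
forms); the floor is `m − s − r`.  §1 is the case `s = κθ^{k₁}`, §3 the case `s = (c/(1−θ))θ^{k₁}`, `AveragedAFCarrierCertified` §4's
margin road the case `s = c₀(1+θ)θ^{k₁}` (consistency `example`s below).  BOOKKEEPING over landed theorems; nothing printed by Bałaban is
asserted; the wall is untouched; Table 9.1 of MISSING-B14 §9 gains no row (the road IS the (AF-0s) row at threshold scale `0`). -/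

section TailDropRoad

open RemainderConstUpperDerived (betaUpperH_of_ceiling_const)

/-- **TAIL DROP × ONE-SIDED LIST × CONSTANT REMAINDER ⟹ THE CARRIER, DEFECT ZERO**: `TailDrop S.β0 k₁ s` (asym), the list
`m ≤ S.β0 k` for `k ≤ k₁` (cap), `RemainderConst S γ₀ r` (asym2/an4) ⟹ `BetaAvgAFH (m − s − r) 0 γ₀ β` — asym2's
`betaLowerH_of_tailDropConst` fed to `betaAvgAFH_of_betaLowerH`.  No (C), no upper bound, no DAG, no `θ`, no limit; slope positive iff
`r < m − s`. [cite: Balaban1987RG1, (2.12)–(2.14) p.268] -/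
theorem betaAvgAFH_of_tailDropConst (S : B12Beta.OneLoopSplit β) {γ₀ s r m : ℝ} {k₁ : ℕ} (htail : TailDrop S.β0 k₁ s)
    (hlist : ∀ k, k ≤ k₁ → m ≤ S.β0 k) (hrem : RemainderConst S γ₀ r) : BetaAvgAFH (m - s - r) 0 γ₀ β :=
  betaAvgAFH_of_betaLowerH (betaLowerH_of_tailDropConst S htail hlist hrem)

/-- Consistency: §1's carrier IS the tail-drop carrier with `s = κθ^{k₁}` (`htail := hall.tailDrop k₁`; same statement, no new declaration). -/
example (S : B12Beta.OneLoopSplit β) {γ₀ κ θ r m : ℝ} {k₁ : ℕ} (hall : AllScalesSeq S.β0 κ θ)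
    (hlist : ∀ k, k ≤ k₁ → m ≤ S.β0 k) (hrem : RemainderConst S γ₀ r) : BetaAvgAFH (m - κ * θ ^ k₁ - r) 0 γ₀ β :=
  betaAvgAFH_of_tailDropConst S (hall.tailDrop k₁) hlist hrem

/-- Consistency: §3's sharper Cauchy carrier IS the tail-drop carrier with `s = (c/(1−θ))θ^{k₁}` (`tailDrop_of_cauchyRate`). -/
example (S : B12Beta.OneLoopSplit β) {γ₀ c θ r m : ℝ} {k₁ : ℕ} (hθ0 : 0 ≤ θ) (hθ1 : θ < 1) (hrate : CauchyRate S.β0 c θ)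
    (hlist : ∀ k, k ≤ k₁ → m ≤ S.β0 k) (hrem : RemainderConst S γ₀ r) : BetaAvgAFH (m - c / (1 - θ) * θ ^ k₁ - r) 0 γ₀ β :=
  betaAvgAFH_of_tailDropConst S (tailDrop_of_cauchyRate hrate hθ0 hθ1 k₁) hlist hrem

/-- Consistency: the two-ended geometric-rate (margin) road of `AveragedAFCarrierCertified` §4 / RCC §7 IS the tail-drop carrier with
`s = c₀(1+θ)θ^{k₁}` (`tailDrop_of_geomRate`, `0 ≤ θ ≤ 1`; the limit value `binf` never enters the floor). -/
example (S : B12Beta.OneLoopSplit β) {γ₀ binf c₀ θ r m : ℝ} {k₁ : ℕ} (hθ0 : 0 ≤ θ) (hθ1 : θ ≤ 1)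
    (hconv : GeomRate S.β0 binf c₀ θ) (hlist : ∀ k, k ≤ k₁ → m ≤ S.β0 k) (hrem : RemainderConst S γ₀ r) :
    BetaAvgAFH (m - c₀ * (1 + θ) * θ ^ k₁ - r) 0 γ₀ β :=
  betaAvgAFH_of_tailDropConst S (tailDrop_of_geomRate hconv hθ0 hθ1 k₁) hlist hrem

/-- **TAIL DROP × CONSTANT ⟹ THE END STATEMENT, [III] SIDE, ALL PROFILES**: the binders of asym2's `thm2Printed_of_tailDropConst` minus
`L`/`hL` (`htail`, `hlist`, `hrem` with `r < m − s` STRICTLY, (C), (U) with `β′ ≥ 0`) + the [III] run-side data ⟹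
`EndpointExistence C ∧ ∃ γ₁ > 0, ∀ γ ≤ min γ₀ γ₁, ∀ runs in ]0,γ], ∀ p′ ≤ p, ∀ A₀ ≥ 0: sizes ∧ HorizonFacts` ((2.6)–(2.9) + (2.46)),
every `β₀ > 0`.  §1's `allScalesConst_END_allProfiles` is the case `htail := hall.tailDrop k₁`.
[cite: Balaban1987RG1, Thm 2 p.259 and Thm 3 p.264] [cite: Balaban1988Convergent, (2.5)–(2.9) pp.255–256, (2.28) p.259, (2.46) p.263] -/
theorem tailDropConst_END_allProfiles {C : B12.Construction} (hgen : ForwardGenerated C β) (hhalt : HaltsOutside C β)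
    (hcur : CurriesHBeta C β) (S : B12Beta.OneLoopSplit β) {γ₀ s r β' m : ℝ} {k₁ : ℕ} (hγ₀ : 0 < γ₀)
    (htail : TailDrop S.β0 k₁ s) (hlist : ∀ k, k ≤ k₁ → m ≤ S.β0 k)
    (hrem : RemainderConst S γ₀ r) (hr : r < m - s)
    (hcont : BetaContH γ₀ β) (hup : BetaUpperH β' γ₀ β) (hβ' : 0 ≤ β')
    {β₀ : ℝ} (hβ₀ : 0 < β₀) {L : ℕ} (hL2 : 2 ≤ L) (p : ℕ) {κ₀ : ℕ} (hκ : 6 ≤ κ₀) :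
    EndpointExistence C ∧ ∃ γ₁ : ℝ, 0 < γ₁ ∧
      ∀ γ : ℝ, 0 < γ → γ ≤ min γ₀ γ₁ → ∀ Pr : B12.RunParams, (C Pr).flow.InInterval γ Pr.K →
        ∀ p' : ℕ, p' ≤ p → ∀ A₀ : ℝ, 0 ≤ A₀ →
          ∃ Rj : ℕ → ℕ, (∀ j, B14.IsRj L p' ((C Pr).flow.g j) (Rj j)) ∧
            HorizonFacts (C Pr).flow β' β₀ A₀ L p' κ₀ Rj Pr.K :=
  (betaAvgAFH_of_tailDropConst S htail hlist hrem).endpoint_and_flowControl_allProfiles (sub_pos.mpr hr) hgen hhalt hcur hγ₀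
    hβ' hβ₀ hL2 p hcont hup hκ

/-- **TAIL DROP × CONSTANT AT SLOPE ≥ 0 ⟹ (2.6)–(2.9) FOR ALL PROFILES, WITHOUT (2.46)** (`r ≤ m − s`; NO continuity).
[cite: Balaban1988Convergent, (2.5)–(2.9) pp.255–256] -/
theorem tailDropConst_flowIneq_allProfiles {C : B12.Construction} (hgen : ForwardGenerated C β) (hhalt : HaltsOutside C β)
    (hcur : CurriesHBeta C β) (S : B12Beta.OneLoopSplit β) {γ₀ s r β' m : ℝ} {k₁ : ℕ} (hγ₀ : 0 < γ₀)
    (htail : TailDrop S.β0 k₁ s) (hlist : ∀ k, k ≤ k₁ → m ≤ S.β0 k)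
    (hrem : RemainderConst S γ₀ r) (hr : r ≤ m - s) (hup : BetaUpperH β' γ₀ β) (hβ' : 0 ≤ β')
    {β₀ : ℝ} (hβ₀ : 0 < β₀) {L : ℕ} (hL2 : 2 ≤ L) (p : ℕ) :
    ∃ γ₁ : ℝ, 0 < γ₁ ∧
      ∀ γ : ℝ, 0 < γ → γ ≤ min γ₀ γ₁ → ∀ Pr : B12.RunParams, (C Pr).flow.InInterval γ Pr.K →
        ∀ p' : ℕ, p' ≤ p → ∀ A₀ : ℝ, 0 ≤ A₀ →
          ∃ Rj : ℕ → ℕ, (∀ j, B14.IsRj L p' ((C Pr).flow.g j) (Rj j)) ∧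
            B14.FlowIneq26 (C Pr).flow.g β' β₀ Pr.K ∧ B14.FlowIneq27 (C Pr).flow.g β' β₀ p' Pr.K ∧
            B14.FlowIneq28 (epsK A₀ p' (C Pr).flow) (C Pr).flow.g β' β₀ Pr.K ∧
            B14FlowStep.FlowIneq29 Rj (C Pr).flow.g L β' β₀ Pr.K :=
  (betaAvgAFH_of_tailDropConst S htail hlist hrem).flowIneq_allProfiles (sub_nonneg.mpr hr) hgen hhalt hcur hγ₀ hβ' hβ₀ hL2 p hup

/-- **TAIL DROP × CONSTANT AT SLOPE ≥ 0 ⟹ THE T⁴ CELL's FLOW-FACT BINDERS** (C19/C20; NO continuity).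
[cite: Balaban1988Convergent, (2.5)–(2.9) pp.255–256] -/
theorem tailDropConst_t4FlowInputs {C : B12.Construction} (hgen : ForwardGenerated C β) (hhalt : HaltsOutside C β)
    (hcur : CurriesHBeta C β) (S : B12Beta.OneLoopSplit β) {γ₀ s r β' m : ℝ} {k₁ : ℕ} (hγ₀ : 0 < γ₀)
    (htail : TailDrop S.β0 k₁ s) (hlist : ∀ k, k ≤ k₁ → m ≤ S.β0 k)
    (hrem : RemainderConst S γ₀ r) (hr : r ≤ m - s) (hup : BetaUpperH β' γ₀ β) (hβ' : 0 ≤ β')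
    {β₀ : ℝ} (hβ₀ : 0 < β₀) {L : ℕ} (hL2 : 2 ≤ L) {p₀ r' : ℕ} (hr' : r' ≤ p₀) :
    ∃ γ₁ : ℝ, 0 < γ₁ ∧ ∀ γ : ℝ, 0 < γ → γ ≤ min γ₀ γ₁ → ∀ Pr : B12.RunParams, (C Pr).flow.InInterval γ Pr.K →
      B14.FlowIneq27 (C Pr).flow.g β' β₀ p₀ Pr.K ∧
      (∀ j, j ≤ Pr.K → 1 ≤ Real.log (((C Pr).flow.g j) ^ 2)⁻¹) ∧
      ∃ Rj : ℕ → ℕ, (∀ j, B14.IsRj L r' ((C Pr).flow.g j) (Rj j)) ∧ B14FlowStep.FlowIneq29 Rj (C Pr).flow.g L β' β₀ Pr.K :=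
  (betaAvgAFH_of_tailDropConst S htail hlist hrem).t4FlowInputs_of_nonneg (sub_nonneg.mpr hr) hgen hhalt hcur hγ₀ hβ' hβ₀ hL2 hr'
    hup

/-! ### (U) DERIVED on the tail-drop road from a level CEILING `S.β0 k ≤ M`: no `hup`, no `hβ′` -/

/-- On the tail-drop × constant road the DERIVED upper constant `β′ = M + r` (RCUD's `betaUpperH_of_ceiling_const` from a level ceiling
`S.β0 k ≤ M`) is non-negative under the list at `k = 0`, the slope condition `r ≤ m − s` and a non-empty box: `0 ≤ r`
(`remainderConst_nonneg`), `0 ≤ s` (`TailDrop.nonneg`), hence `0 ≤ m ≤ S.β0 0 ≤ M`. [folklore] -/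
theorem betaPrime_ceiling_nonneg (S : B12Beta.OneLoopSplit β) {γ₀ s r M m : ℝ} {k₁ : ℕ} (hγ₀ : 0 < γ₀)
    (htail : TailDrop S.β0 k₁ s) (hlist : ∀ k, k ≤ k₁ → m ≤ S.β0 k) (hceil : ∀ k, S.β0 k ≤ M)
    (hrem : RemainderConst S γ₀ r) (hr : r ≤ m - s) : 0 ≤ M + r := by
  have h0 : m ≤ S.β0 0 := hlist 0 (Nat.zero_le _)
  have hM : S.β0 0 ≤ M := hceil 0
  have hs : 0 ≤ s := htail.nonneg
  have hr0 : 0 ≤ r := remainderConst_nonneg S hγ₀ hrem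
  linarith

/-- **END + THE [III] LIST, ALL PROFILES, (U) DERIVED FROM A LEVEL CEILING** (`β′ = M + r`): binders DAG/run-side, `S`, `htail`,
`hlist`, `hceil : ∀ k, S.β0 k ≤ M`, `hrem`, `r < m − s`, (C), `0 < β₀`, `L ≥ 2`, `p`, `κ₀ ≥ 6` — no `hup`, no `hβ′`.  The END-grade content
of the pair (all-scales floor, all-scales level-0 band) on §1's `_cont` road is (tail drop at depth `k₁`, a uniform ceiling): §1's
`allScalesConst_END_allProfiles_cont` is the case `htail := hall.tailDrop k₁`, `hceil := hall.ceiling_zero` (`M = β⁰_1 + κ`).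
[cite: Balaban1987RG1, Thm 2 p.259 and Thm 3 p.264] [cite: Balaban1988Convergent, (2.5)–(2.9) pp.255–256, (2.28) p.259, (2.46) p.263] -/
theorem tailDropCeilingConst_END_allProfiles_cont {C : B12.Construction} (hgen : ForwardGenerated C β)
    (hhalt : HaltsOutside C β) (hcur : CurriesHBeta C β) (S : B12Beta.OneLoopSplit β) {γ₀ s r M m : ℝ} {k₁ : ℕ}
    (hγ₀ : 0 < γ₀) (htail : TailDrop S.β0 k₁ s) (hlist : ∀ k, k ≤ k₁ → m ≤ S.β0 k) (hceil : ∀ k, S.β0 k ≤ M)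
    (hrem : RemainderConst S γ₀ r) (hr : r < m - s) (hcont : BetaContH γ₀ β)
    {β₀ : ℝ} (hβ₀ : 0 < β₀) {L : ℕ} (hL2 : 2 ≤ L) (p : ℕ) {κ₀ : ℕ} (hκ : 6 ≤ κ₀) :
    EndpointExistence C ∧ ∃ γ₁ : ℝ, 0 < γ₁ ∧
      ∀ γ : ℝ, 0 < γ → γ ≤ min γ₀ γ₁ → ∀ Pr : B12.RunParams, (C Pr).flow.InInterval γ Pr.K →
        ∀ p' : ℕ, p' ≤ p → ∀ A₀ : ℝ, 0 ≤ A₀ →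
          ∃ Rj : ℕ → ℕ, (∀ j, B14.IsRj L p' ((C Pr).flow.g j) (Rj j)) ∧
            HorizonFacts (C Pr).flow (M + r) β₀ A₀ L p' κ₀ Rj Pr.K :=
  tailDropConst_END_allProfiles hgen hhalt hcur S hγ₀ htail hlist hrem hr hcont (betaUpperH_of_ceiling_const S hceil hrem)
    (betaPrime_ceiling_nonneg S hγ₀ htail hlist hceil hrem hr.le) hβ₀ hL2 p hκ

/-- Consistency: §1's (U)-derived END is the case `htail := hall.tailDrop k₁`, `hceil := hall.ceiling_zero` (`M = β⁰_1 + κ`; the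
`HorizonFacts` constant `β⁰_1 + κ + r` of `allScalesConst_END_allProfiles_cont` re-obtained, no new declaration). -/
example {C : B12.Construction} (hgen : ForwardGenerated C β) (hhalt : HaltsOutside C β) (hcur : CurriesHBeta C β)
    (S : B12Beta.OneLoopSplit β) {γ₀ κ θ r m : ℝ} {k₁ : ℕ} (hγ₀ : 0 < γ₀) (hall : AllScalesSeq S.β0 κ θ)
    (hlist : ∀ k, k ≤ k₁ → m ≤ S.β0 k) (hrem : RemainderConst S γ₀ r) (hr : r < m - κ * θ ^ k₁) (hcont : BetaContH γ₀ β)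
    {β₀ : ℝ} (hβ₀ : 0 < β₀) {L : ℕ} (hL2 : 2 ≤ L) (p : ℕ) {κ₀ : ℕ} (hκ : 6 ≤ κ₀) :
    EndpointExistence C ∧ ∃ γ₁ : ℝ, 0 < γ₁ ∧
      ∀ γ : ℝ, 0 < γ → γ ≤ min γ₀ γ₁ → ∀ Pr : B12.RunParams, (C Pr).flow.InInterval γ Pr.K →
        ∀ p' : ℕ, p' ≤ p → ∀ A₀ : ℝ, 0 ≤ A₀ →
          ∃ Rj : ℕ → ℕ, (∀ j, B14.IsRj L p' ((C Pr).flow.g j) (Rj j)) ∧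
            HorizonFacts (C Pr).flow (S.β0 0 + κ + r) β₀ A₀ L p' κ₀ Rj Pr.K :=
  tailDropCeilingConst_END_allProfiles_cont hgen hhalt hcur S hγ₀ (hall.tailDrop k₁) hlist hall.ceiling_zero hrem hr hcont hβ₀
    hL2 p hκ

/-- **(2.6)–(2.9) FOR ALL PROFILES AT SLOPE ≥ 0 on the tail-drop road, (U) DERIVED FROM A LEVEL CEILING** — no `hup`, no `hβ′`, no (C).
[cite: Balaban1988Convergent, (2.5)–(2.9) pp.255–256] -/
theorem tailDropCeilingConst_flowIneq_allProfiles_cont {C : B12.Construction} (hgen : ForwardGenerated C β)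
    (hhalt : HaltsOutside C β) (hcur : CurriesHBeta C β) (S : B12Beta.OneLoopSplit β) {γ₀ s r M m : ℝ} {k₁ : ℕ}
    (hγ₀ : 0 < γ₀) (htail : TailDrop S.β0 k₁ s) (hlist : ∀ k, k ≤ k₁ → m ≤ S.β0 k) (hceil : ∀ k, S.β0 k ≤ M)
    (hrem : RemainderConst S γ₀ r) (hr : r ≤ m - s)
    {β₀ : ℝ} (hβ₀ : 0 < β₀) {L : ℕ} (hL2 : 2 ≤ L) (p : ℕ) :
    ∃ γ₁ : ℝ, 0 < γ₁ ∧
      ∀ γ : ℝ, 0 < γ → γ ≤ min γ₀ γ₁ → ∀ Pr : B12.RunParams, (C Pr).flow.InInterval γ Pr.K →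
        ∀ p' : ℕ, p' ≤ p → ∀ A₀ : ℝ, 0 ≤ A₀ →
          ∃ Rj : ℕ → ℕ, (∀ j, B14.IsRj L p' ((C Pr).flow.g j) (Rj j)) ∧
            B14.FlowIneq26 (C Pr).flow.g (M + r) β₀ Pr.K ∧ B14.FlowIneq27 (C Pr).flow.g (M + r) β₀ p' Pr.K ∧
            B14.FlowIneq28 (epsK A₀ p' (C Pr).flow) (C Pr).flow.g (M + r) β₀ Pr.K ∧
            B14FlowStep.FlowIneq29 Rj (C Pr).flow.g L (M + r) β₀ Pr.K :=
  tailDropConst_flowIneq_allProfiles hgen hhalt hcur S hγ₀ htail hlist hrem hr (betaUpperH_of_ceiling_const S hceil hrem)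
    (betaPrime_ceiling_nonneg S hγ₀ htail hlist hceil hrem hr) hβ₀ hL2 p

/-- **THE T⁴ CELL's FLOW-FACT BINDERS AT SLOPE ≥ 0 on the tail-drop road, (U) DERIVED FROM A LEVEL CEILING** — no `hup`, no `hβ′`, no (C).
[cite: Balaban1988Convergent, (2.5)–(2.9) pp.255–256] -/
theorem tailDropCeilingConst_t4FlowInputs_cont {C : B12.Construction} (hgen : ForwardGenerated C β)
    (hhalt : HaltsOutside C β) (hcur : CurriesHBeta C β) (S : B12Beta.OneLoopSplit β) {γ₀ s r M m : ℝ} {k₁ : ℕ}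
    (hγ₀ : 0 < γ₀) (htail : TailDrop S.β0 k₁ s) (hlist : ∀ k, k ≤ k₁ → m ≤ S.β0 k) (hceil : ∀ k, S.β0 k ≤ M)
    (hrem : RemainderConst S γ₀ r) (hr : r ≤ m - s)
    {β₀ : ℝ} (hβ₀ : 0 < β₀) {L : ℕ} (hL2 : 2 ≤ L) {p₀ r' : ℕ} (hr' : r' ≤ p₀) :
    ∃ γ₁ : ℝ, 0 < γ₁ ∧ ∀ γ : ℝ, 0 < γ → γ ≤ min γ₀ γ₁ → ∀ Pr : B12.RunParams, (C Pr).flow.InInterval γ Pr.K →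
      B14.FlowIneq27 (C Pr).flow.g (M + r) β₀ p₀ Pr.K ∧
      (∀ j, j ≤ Pr.K → 1 ≤ Real.log (((C Pr).flow.g j) ^ 2)⁻¹) ∧
      ∃ Rj : ℕ → ℕ, (∀ j, B14.IsRj L r' ((C Pr).flow.g j) (Rj j)) ∧
        B14FlowStep.FlowIneq29 Rj (C Pr).flow.g L (M + r) β₀ Pr.K :=
  tailDropConst_t4FlowInputs hgen hhalt hcur S hγ₀ htail hlist hrem hr (betaUpperH_of_ceiling_const S hceil hrem)
    (betaPrime_ceiling_nonneg S hγ₀ htail hlist hceil hrem hr) hβ₀ hL2 hr'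

end TailDropRoad

/-! ### Non-vacuity of §6 on asym2's OSCILLATING split, ONE LEVEL DEEPER (`k₁ = 1`, budget `0`) -/

namespace Witness

open RemainderConstAllScales.Witness (oscFamily splitOsc list_splitOsc remainderConst_splitOsc tailDrop_splitOsc
  tailDrop_splitOsc_one list_splitOsc_one)

/-- On asym2's oscillating split (`β⁰_{k+1} = 1 + (−1)^k/4`) the depth-`0` tail-drop road reproduces §5's carrier: list `5/4 ≤ β⁰_1`,
budget `s = 1/2` (`tailDrop_splitOsc`), remainder `0` ⟹ `BetaAvgAFH (5/4 − 1/2 − 0) 0 1 oscFamily`. [folklore] -/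
theorem tailDropConst_carrier_osc : BetaAvgAFH (5 / 4 - 1 / 2 - 0) 0 1 oscFamily :=
  betaAvgAFH_of_tailDropConst splitOsc tailDrop_splitOsc list_splitOsc remainderConst_splitOsc

/-- … and ONE LEVEL DEEPER (`k₁ = 1`: list `3/4 ≤ β⁰_1, β⁰_2`, budget `s = 0` by `tailDrop_splitOsc_one`) the carrier
`BetaAvgAFH (3/4 − 0 − 0) 0 1 oscFamily` — the SAME slope `3/4` as §5 / the depth-`0` road, with the whole oscillation allowance moved
out of the budget `s` into the certified list: certifying deeper trades `m` against `s`, the floor `m − s` is what the consumers see. [folklore] -/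
theorem tailDropConst_carrier_osc_one : BetaAvgAFH (3 / 4 - 0 - 0) 0 1 oscFamily :=
  betaAvgAFH_of_tailDropConst splitOsc tailDrop_splitOsc_one list_splitOsc_one remainderConst_splitOsc

/-- The two floors coincide (`5/4 − 1/2 − 0 = 3/4 − 0 − 0`) and are positive, so every consumer of §6 applies to this family at
either depth. [folklore] -/
theorem tailDropConst_carrier_osc_floors : (5 / 4 - 1 / 2 - 0 : ℝ) = 3 / 4 - 0 - 0 ∧ (0 : ℝ) < 3 / 4 - 0 - 0 := by norm_num

end Witness

end

end Literature.MathematicalPhysics.QuantumFieldTheory.Balaban1983to89.Beta.AveragedAFCarrierAllScales
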